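import Mathlib

/-!
# Clean-pair atom §6: scale parameters for large `n` (`SnSubsetDichotomy.HyperoctahedralThreshold`, stmt-10883)

Helper for crux `SnSubsetDichotomy.HyperoctahedralThreshold` (stmt-MatrixMultiplication-10883), line
`stub_plan_poorRigidCore`, clean-pair atom §6 (proof plan `work/ATOM_PROOF.md` of the stub-plan seat): the existence
of admissible scale parameters for every large `n`.

Pure arithmetic.  With `L := Nat.log 2 n + 1` (so `2^(L-1) ≤ n < 2^L`), `a := 2^26 L²`, `r := 2 (L/128 + 1)`,
`q := 128 (a+1)² 2^(L/11+1)`, `s₀ := q²`, `t₁ := Nat.log 2 (3 s₀)`, `D₀ := 2^(a-2L-2)`,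
`Φ₀ := (4 (2a)²)^(Nat.log 2 (2a) + 1) (Rc + 1)` and any `Rc ≤ n^{3/4}`, the sixteen inequalities consumed by the
final assembly `cleanPair_of_params` hold for all `n ≥ 2^(2^22)` (`stub_atomParams`, registered form).

Method: every quantity is bounded by `2^(explicit exponent)`, the exponent being linear in `L`, `L/11`, `L/128`,
`(3L+3)/4` and quadratic in some `ℓ` with `L < 2^(ℓ+1)`; the single growth fact
`CleanPair.Params.growth : 512 (ℓ+20)² ≤ 2^ℓ` (`ℓ ≥ 20`), giving `512 (ℓ+20)² ≤ L`, then closes every exponent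
comparison by linear arithmetic.  The two real-valued conjuncts are reduced to `(2a)^4 ≤ n`
(`CleanPair.Params.quarter_bound`) and the real hypothesis `Rc ≤ n^{3/4}` to `Rc + 1 ≤ 2^((3L+3)/4)`
(`CleanPair.Params.rc_bound`).
-/

-- the tree's namespace `Summit.MatrixMultiplication.MatrixMultiplication.…` repeats a component by design
set_option linter.dupNamespace false

namespace Summit.MatrixMultiplication.MatrixMultiplication.Theorems.HyperoctahedralThreshold

namespace CleanPair.Params

/-- `2^ℓ` dominates the quadratic `512 (ℓ + 20)²` from `ℓ = 20` on. -/
theorem growth (ℓ : ℕ) (h : 20 ≤ ℓ) : 512 * (ℓ + 20) ^ 2 ≤ 2 ^ ℓ := by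
  induction ℓ, h using Nat.le_induction with
  | base => norm_num
  | succ m hm ih =>
    have h2 : 2 ^ (m + 1) = 2 ^ m * 2 := pow_succ 2 m
    rw [h2]
    nlinarith [ih]

/-- Products of dyadic bounds: `x ≤ 2^i`, `y ≤ 2^j` and `i + j ≤ k` give `x * y ≤ 2^k`. -/
theorem mul_le_pow {x y i j k : ℕ} (hx : x ≤ 2 ^ i) (hy : y ≤ 2 ^ j) (hk : i + j ≤ k) :
    x * y ≤ 2 ^ k :=
  (Nat.mul_le_mul hx hy).trans (by rw [← pow_add]; exact Nat.pow_le_pow_right (by norm_num) hk)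

/-- The real hypothesis `Rc ≤ n^{3/4}` with `n < 2^L` gives the dyadic bound `Rc + 1 ≤ 2^P` once `3L ≤ 4P`. -/
theorem rc_bound {n Rc L P : ℕ} (hRc : (Rc : ℝ) ≤ (n : ℝ) ^ ((3 : ℝ) / 4)) (hn : n < 2 ^ L)
    (hP : 3 * L ≤ 4 * P) : Rc + 1 ≤ 2 ^ P := by
  have h1 : (n : ℝ) < (2 : ℝ) ^ (L : ℕ) := by exact_mod_cast hn
  have h2 : (n : ℝ) ^ ((3 : ℝ) / 4) < ((2 : ℝ) ^ (L : ℕ)) ^ ((3 : ℝ) / 4) :=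
    Real.rpow_lt_rpow (Nat.cast_nonneg _) h1 (by norm_num)
  have h3 : ((2 : ℝ) ^ (L : ℕ)) ^ ((3 : ℝ) / 4) = (2 : ℝ) ^ ((L : ℝ) * (3 / 4)) := by
    rw [← Real.rpow_natCast, ← Real.rpow_mul (by norm_num)]
  have hP' : (L : ℝ) * (3 / 4) ≤ ((P : ℕ) : ℝ) := by
    have : ((3 * L : ℕ) : ℝ) ≤ ((4 * P : ℕ) : ℝ) := by exact_mod_cast hP
    push_cast at this
    linarith
  have h4 : (2 : ℝ) ^ ((L : ℝ) * (3 / 4)) ≤ (2 : ℝ) ^ ((P : ℕ) : ℝ) :=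
    Real.rpow_le_rpow_of_exponent_le (by norm_num) hP'
  have h5 : (2 : ℝ) ^ ((P : ℕ) : ℝ) = ((2 ^ P : ℕ) : ℝ) := by
    rw [Real.rpow_natCast]; push_cast; rfl
  have h6 : (Rc : ℝ) < ((2 ^ P : ℕ) : ℝ) := by
    calc (Rc : ℝ) ≤ _ := hRc
      _ < _ := h2
      _ = _ := h3
      _ ≤ _ := h4
      _ = _ := h5
  have h7 : Rc < 2 ^ P := by exact_mod_cast h6
  omega

/-- `(2a)^4 ≤ n` gives the real bound `2a ≤ n^{1/4}`. -/
theorem quarter_bound {a n : ℕ} (h4 : (2 * a) ^ 4 ≤ n) : ((2 * a : ℕ) : ℝ) ≤ (n : ℝ) ^ ((1 : ℝ) / 4) := by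
  have hcast : (((2 * a : ℕ) : ℝ)) ^ (4 : ℕ) ≤ (n : ℝ) := by exact_mod_cast h4
  calc ((2 * a : ℕ) : ℝ) = ((((2 * a : ℕ) : ℝ)) ^ (4 : ℕ)) ^ ((1 : ℝ) / 4) := by
        rw [one_div, show ((4 : ℝ)) = ((4 : ℕ) : ℝ) by norm_num,
          Real.pow_rpow_inv_natCast (by positivity) (by norm_num)]
    _ ≤ (n : ℝ) ^ ((1 : ℝ) / 4) := Real.rpow_le_rpow (by positivity) hcast (by norm_num)

/-- The scale: from `2^(2^22) ≤ n`, the binary length `L = Nat.log 2 n + 1` satisfies `2 ≤ n`, `2^(L-1) ≤ n < 2^L`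
and dominates `512 w` for some `ℓ, w` with `L < 2^(ℓ+1)`, `40ℓ + 400 ≤ w`, `(60+4ℓ)(29+2ℓ) ≤ 8w`
(namely `ℓ := Nat.log 2 L ≥ 20`, `w := (ℓ+20)²`). -/
theorem scale {n L : ℕ} (hn : 2 ^ 2 ^ 22 ≤ n) (hL : L = Nat.log 2 n + 1) :
    2 ≤ n ∧ 2 ^ (L - 1) ≤ n ∧ n < 2 ^ L ∧ ∃ ℓ w : ℕ, L < 2 ^ (ℓ + 1) ∧ 40 * ℓ + 400 ≤ w ∧
      (60 + 4 * ℓ) * (29 + 2 * ℓ) ≤ 8 * w ∧ 512 * w ≤ L := by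
  have hn0 : n ≠ 0 := (lt_of_lt_of_le (Nat.two_pow_pos _) hn).ne'
  have hlog : 2 ^ 22 ≤ Nat.log 2 n := Nat.le_log_of_pow_le one_lt_two hn
  clear hn
  refine ⟨?_, ?_, ?_, ?_⟩
  · have h := Nat.pow_le_of_le_log hn0 (show 1 ≤ Nat.log 2 n by omega)
    simpa using h
  · rw [hL, Nat.add_sub_cancel]; exact Nat.pow_log_le_self 2 hn0
  · rw [hL]; exact Nat.lt_pow_succ_log_self one_lt_two n
  · have hL0 : L ≠ 0 := by omega
    have hℓ20 : 20 ≤ Nat.log 2 L :=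
      Nat.le_log_of_pow_le one_lt_two (le_trans (by norm_num : 2 ^ 20 ≤ 2 ^ 22) (by omega))
    refine ⟨Nat.log 2 L, (Nat.log 2 L + 20) ^ 2, Nat.lt_pow_succ_log_self one_lt_two L, by nlinarith,
      by nlinarith, ?_⟩
    exact (growth _ hℓ20).trans (Nat.pow_log_le_self 2 hL0)

/-- Dyadic sizes of `a = 2^26 L²` in terms of `ℓ` with `L < 2^(ℓ+1)`. -/
theorem a_bounds {L a ℓ : ℕ} (ha : a = 2 ^ 26 * L ^ 2) (hℓ : L < 2 ^ (ℓ + 1)) :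
    a + 1 ≤ 2 ^ (28 + 2 * ℓ) ∧ (a + 1) ^ 2 ≤ 2 ^ (56 + 4 * ℓ) ∧ 4 * (2 * a) ^ 2 ≤ 2 ^ (60 + 4 * ℓ) ∧
      Nat.log 2 (2 * a) + 1 ≤ 29 + 2 * ℓ := by
  have hL2 : L ^ 2 < 2 ^ (2 * ℓ + 2) := by
    calc L ^ 2 < (2 ^ (ℓ + 1)) ^ 2 := Nat.pow_lt_pow_left hℓ (by norm_num)
      _ = 2 ^ (2 * ℓ + 2) := by rw [← pow_mul]; ring_nf
  have h1 : a + 1 ≤ 2 ^ (28 + 2 * ℓ) := by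
    have h : 2 ^ (28 + 2 * ℓ) = 2 ^ 26 * 2 ^ (2 * ℓ + 2) := by rw [← pow_add]; ring_nf
    rw [h, ha]; omega
  have ha' : a ≤ 2 ^ (28 + 2 * ℓ) := by omega
  have h2 : (a + 1) ^ 2 ≤ 2 ^ (56 + 4 * ℓ) := by
    rw [pow_two]; exact mul_le_pow h1 h1 (by omega)
  have h3 : 4 * (2 * a) ^ 2 ≤ 2 ^ (60 + 4 * ℓ) := by
    rw [show 4 * (2 * a) ^ 2 = 16 * (a * a) by ring]
    exact mul_le_pow (show 16 ≤ 2 ^ 4 by norm_num) (mul_le_pow ha' ha' le_rfl) (by omega)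
  have h4 : Nat.log 2 (2 * a) + 1 ≤ 29 + 2 * ℓ := by
    have h2a : 2 * a < 2 ^ (29 + 2 * ℓ) := by
      have h : 2 ^ (29 + 2 * ℓ) = 2 * 2 ^ (28 + 2 * ℓ) := by ring
      rw [h]; omega
    have := Nat.log_lt_of_lt_pow' (b := 2) (by omega : 29 + 2 * ℓ ≠ 0) h2a
    omega
  exact ⟨h1, h2, h3, h4⟩

/-- `Φ₀ = (4 (2a)²)^(Nat.log 2 (2a) + 1) (Rc + 1) ≤ 2^((60+4ℓ)(29+2ℓ) + P)`. -/
theorem phi_bound {a Rc P ℓ Φ₀ : ℕ} (h3 : 4 * (2 * a) ^ 2 ≤ 2 ^ (60 + 4 * ℓ))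
    (h4 : Nat.log 2 (2 * a) + 1 ≤ 29 + 2 * ℓ) (hRc : Rc + 1 ≤ 2 ^ P)
    (hΦ : Φ₀ = (4 * (2 * a) ^ 2) ^ (Nat.log 2 (2 * a) + 1) * (Rc + 1)) :
    Φ₀ ≤ 2 ^ ((60 + 4 * ℓ) * (29 + 2 * ℓ) + P) := by
  rw [hΦ, pow_add 2 ((60 + 4 * ℓ) * (29 + 2 * ℓ)) P]
  refine Nat.mul_le_mul ?_ hRc
  calc (4 * (2 * a) ^ 2) ^ (Nat.log 2 (2 * a) + 1)
      ≤ (2 ^ (60 + 4 * ℓ)) ^ (Nat.log 2 (2 * a) + 1) := Nat.pow_le_pow_left h3 _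
    _ ≤ (2 ^ (60 + 4 * ℓ)) ^ (29 + 2 * ℓ) := Nat.pow_le_pow_right (by positivity) h4
    _ = 2 ^ ((60 + 4 * ℓ) * (29 + 2 * ℓ)) := by rw [← pow_mul]

/-- Dyadic sizes of `s₀ = q²` and `t₁ = Nat.log 2 (3 s₀)`. -/
theorem q_bounds {L a q s₀ t₁ ℓ : ℕ} (h2 : (a + 1) ^ 2 ≤ 2 ^ (56 + 4 * ℓ))
    (hq : q = 128 * (a + 1) ^ 2 * 2 ^ (L / 11 + 1)) (hs : s₀ = q ^ 2) (ht : t₁ = Nat.log 2 (3 * s₀)) :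
    s₀ ≤ 2 ^ (128 + 8 * ℓ + 2 * (L / 11)) ∧ t₁ < 130 + 8 * ℓ + 2 * (L / 11) := by
  have hq' : q ≤ 2 ^ (64 + 4 * ℓ + L / 11) := by
    rw [hq]
    exact mul_le_pow (mul_le_pow (show 128 ≤ 2 ^ 7 by norm_num) h2 le_rfl) le_rfl (by omega)
  have hs' : s₀ ≤ 2 ^ (128 + 8 * ℓ + 2 * (L / 11)) := by
    rw [hs, pow_two]
    exact mul_le_pow hq' hq' (by omega)
  refine ⟨hs', ?_⟩
  rw [ht]
  refine Nat.log_lt_of_lt_pow' (by omega) ?_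
  have h : 2 ^ (130 + 8 * ℓ + 2 * (L / 11)) = 4 * 2 ^ (128 + 8 * ℓ + 2 * (L / 11)) := by ring
  have := Nat.two_pow_pos (128 + 8 * ℓ + 2 * (L / 11))
  rw [h]; omega

/-- The elementary conjuncts (only `11 ≤ L` is used). -/
theorem part1 {n L a r q s₀ t₁ D₀ : ℕ} (hnL : n < 2 ^ L) (hL : 11 ≤ L)
    (ha : a = 2 ^ 26 * L ^ 2) (hr : r = 2 * (L / 128 + 1)) (hq : q = 128 * (a + 1) ^ 2 * 2 ^ (L / 11 + 1))
    (hs : s₀ = q ^ 2) (ht : t₁ = Nat.log 2 (3 * s₀)) (hD : D₀ = 2 ^ (a - 2 * L - 2)) :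
    1 ≤ a ∧ r ≤ a ∧ 0 < s₀ ∧ 3 * s₀ < 2 ^ (t₁ + 1) ∧ 64 * (a + 1) ^ 2 ≤ Nat.sqrt s₀ ∧
    3 * 2 ^ a < D₀ * 3 ^ (2 * L + 3 + 1) ∧
    3 * 2 ^ a * (64 * (a + 1) ^ 2) ^ (21 + 1) < D₀ * Nat.sqrt s₀ ^ (21 + 1) ∧
    2 ^ (a - (2 * L + 3) + 1) ≤ D₀ ∧ 2 * L + 3 ≤ a ∧ 4 * n ^ 2 * D₀ ≤ 3 * 2 ^ a := by
  have h5L : 5 * L ≤ a := by rw [ha]; nlinarith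
  have hsq : Nat.sqrt s₀ = q := by rw [hs, Nat.sqrt_eq']
  have hqK : q = 64 * (a + 1) ^ 2 * 2 ^ (L / 11 + 2) := by rw [hq]; ring
  have hq0 : 0 < q := by rw [hq]; positivity
  have hD0 : 0 < D₀ := by rw [hD]; positivity
  have h2a : 2 ^ a = D₀ * 2 ^ (2 * L + 2) := by rw [hD, ← pow_add]; congr 1; omega
  refine ⟨by omega, by omega, by rw [hs]; positivity, ?_, ?_, ?_, ?_, ?_, by omega, ?_⟩
  · rw [ht]; exact Nat.lt_pow_succ_log_self one_lt_two _
  · rw [hsq, hqK]; exact Nat.le_mul_of_pos_right _ (by positivity)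
  · rw [h2a, show 2 * L + 3 + 1 = (2 * L + 2) + 2 by omega, pow_add 3 (2 * L + 2) 2]
    have h23 : 2 ^ (2 * L + 2) ≤ 3 ^ (2 * L + 2) := Nat.pow_le_pow_left (by norm_num) _
    have h3p : 0 < 3 ^ (2 * L + 2) := by positivity
    nlinarith
  · rw [hsq, hqK]
    generalize hK : 64 * (a + 1) ^ 2 = K
    have hK0 : 0 < K := by rw [← hK]; positivity
    have hlt : 3 * 2 ^ (2 * L + 2) < 2 ^ ((L / 11 + 2) * (21 + 1)) := by
      calc 3 * 2 ^ (2 * L + 2) < 4 * 2 ^ (2 * L + 2) := by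
            have := Nat.two_pow_pos (2 * L + 2); omega
        _ = 2 ^ (2 * L + 4) := by ring
        _ ≤ 2 ^ ((L / 11 + 2) * (21 + 1)) := Nat.pow_le_pow_right (by norm_num) (by omega)
    calc 3 * 2 ^ a * K ^ (21 + 1) = 3 * 2 ^ (2 * L + 2) * (D₀ * K ^ (21 + 1)) := by rw [h2a]; ring
      _ < 2 ^ ((L / 11 + 2) * (21 + 1)) * (D₀ * K ^ (21 + 1)) :=
          Nat.mul_lt_mul_of_pos_right hlt (by positivity)
      _ = D₀ * (K * 2 ^ (L / 11 + 2)) ^ (21 + 1) := by ring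
  · rw [hD]; exact le_of_eq (by congr 1; omega)
  · calc 4 * n ^ 2 * D₀ ≤ 4 * (2 ^ L) ^ 2 * D₀ := by gcongr
      _ = 2 ^ a := by rw [h2a]; ring
      _ ≤ 3 * 2 ^ a := by omega

/-- The conjuncts controlled by the growth condition `512 w ≤ L`, except the budget inequality. -/
theorem part2 {n L a r t₁ ℓ w : ℕ} (hLn : 2 ^ (L - 1) ≤ n) (hwℓ : 40 * ℓ + 400 ≤ w) (hwL : 512 * w ≤ L)
    (ha : a = 2 ^ 26 * L ^ 2) (hr : r = 2 * (L / 128 + 1))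
    (h1 : a + 1 ≤ 2 ^ (28 + 2 * ℓ)) (h2 : (a + 1) ^ 2 ≤ 2 ^ (56 + 4 * ℓ))
    (ht' : t₁ < 130 + 8 * ℓ + 2 * (L / 11)) :
    (2 * a) ^ 4 ≤ n ∧ 288 * (a + 1) ^ 2 ≤ 2 ^ (r / 2) ∧
      2 ^ 21 * ((2 * L + 3) + (2 * L + 3) * t₁) ≤ a := by
  refine ⟨?_, mul_le_pow (show 288 ≤ 2 ^ 9 by norm_num) h2 (by omega), ?_⟩
  · calc (2 * a) ^ 4 ≤ (2 * 2 ^ (28 + 2 * ℓ)) ^ 4 := Nat.pow_le_pow_left (by omega) 4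
      _ = 2 ^ (116 + 8 * ℓ) := by ring
      _ ≤ 2 ^ (L - 1) := Nat.pow_le_pow_right (by norm_num) (by omega)
      _ ≤ n := hLn
  · have h3L : 2 * L + 3 ≤ 3 * L := by omega
    have ht2 : t₁ + 1 ≤ 2 * L := by omega
    calc 2 ^ 21 * ((2 * L + 3) + (2 * L + 3) * t₁) = 2 ^ 21 * ((2 * L + 3) * (t₁ + 1)) := by ring
      _ ≤ 2 ^ 21 * ((3 * L) * (2 * L)) := Nat.mul_le_mul_left _ (Nat.mul_le_mul h3L ht2)
      _ = 2 ^ 21 * 6 * L ^ 2 := by ring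
      _ ≤ 2 ^ 21 * 32 * L ^ 2 := Nat.mul_le_mul_right _ (Nat.mul_le_mul_left _ (by norm_num))
      _ = a := by rw [ha]; ring

/-- The budget inequality `16(a+1)(Rc + 3·2^(2r+1)Φ₀ + 6 a s₀ Φ₀) + 16(a+1)²(3·2^(r+1))(Φ₀+1) ≤ n`:
each of the two summands is at most `2^(L-2)`, and `2^(L-1) ≤ n`. -/
theorem part3 {n Rc L a r s₀ Φ₀ P ℓ w : ℕ} (hLn : 2 ^ (L - 1) ≤ n) (hwℓ : 40 * ℓ + 400 ≤ w)
    (hEw : (60 + 4 * ℓ) * (29 + 2 * ℓ) ≤ 8 * w) (hwL : 512 * w ≤ L) (hP : P = (3 * L + 3) / 4)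
    (hRc : Rc + 1 ≤ 2 ^ P) (hr : r = 2 * (L / 128 + 1))
    (h1 : a + 1 ≤ 2 ^ (28 + 2 * ℓ)) (h2 : (a + 1) ^ 2 ≤ 2 ^ (56 + 4 * ℓ))
    (hs' : s₀ ≤ 2 ^ (128 + 8 * ℓ + 2 * (L / 11)))
    (hΦ' : Φ₀ ≤ 2 ^ ((60 + 4 * ℓ) * (29 + 2 * ℓ) + P)) :
    16 * (a + 1) * (Rc + 3 * 2 ^ (2 * r + 1) * Φ₀ + 6 * a * s₀ * Φ₀) +
      16 * (a + 1) ^ 2 * (3 * 2 ^ (r + 1)) * (Φ₀ + 1) ≤ n := by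
  obtain ⟨E, hE, hEw'⟩ : ∃ E, Φ₀ ≤ 2 ^ (E + P) ∧ E ≤ 8 * w := ⟨_, hΦ', hEw⟩
  clear hΦ' hEw
  have h16 : 16 ≤ 2 ^ 4 := by norm_num
  have h3 : 3 ≤ 2 ^ 2 := by norm_num
  have h6 : 6 ≤ 2 ^ 3 := by norm_num
  have hRc' : Rc ≤ 2 ^ P := by omega
  have ha' : a ≤ 2 ^ (28 + 2 * ℓ) := by omega
  -- a common dyadic exponent for the three inner summands
  obtain ⟨e, he⟩ : ∃ e, e = 159 + 10 * ℓ + 2 * (L / 11) + 2 * r + E + P := ⟨_, rfl⟩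
  have hB1 : Rc ≤ 2 ^ e := hRc'.trans (Nat.pow_le_pow_right (by norm_num) (by omega))
  have hB2 : 3 * 2 ^ (2 * r + 1) * Φ₀ ≤ 2 ^ e := mul_le_pow (mul_le_pow h3 le_rfl le_rfl) hE (by omega)
  have hB3 : 6 * a * s₀ * Φ₀ ≤ 2 ^ e :=
    mul_le_pow (mul_le_pow (mul_le_pow h6 ha' le_rfl) hs' le_rfl) hE (by omega)
  have hB : Rc + 3 * 2 ^ (2 * r + 1) * Φ₀ + 6 * a * s₀ * Φ₀ ≤ 2 ^ (e + 2) := by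
    have : 2 ^ (e + 2) = 4 * 2 ^ e := by ring
    omega
  have hT1 : 16 * (a + 1) * (Rc + 3 * 2 ^ (2 * r + 1) * Φ₀ + 6 * a * s₀ * Φ₀) ≤ 2 ^ (L - 2) :=
    mul_le_pow (mul_le_pow h16 h1 le_rfl) hB (by omega)
  have hΦ1 : Φ₀ + 1 ≤ 2 ^ (E + P + 1) := by
    have : 2 ^ (E + P + 1) = 2 * 2 ^ (E + P) := by ring
    have := Nat.two_pow_pos (E + P)
    omega
  have hT2 : 16 * (a + 1) ^ 2 * (3 * 2 ^ (r + 1)) * (Φ₀ + 1) ≤ 2 ^ (L - 2) :=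
    mul_le_pow (mul_le_pow (mul_le_pow h16 h2 le_rfl) (mul_le_pow h3 le_rfl le_rfl) le_rfl) hΦ1 (by omega)
  have hsum : 2 ^ (L - 2) + 2 ^ (L - 2) = 2 ^ (L - 1) := by
    have hL : L - 1 = (L - 2) + 1 := by omega
    rw [hL, pow_succ]; ring
  calc _ ≤ 2 ^ (L - 2) + 2 ^ (L - 2) := add_le_add hT1 hT2
    _ = 2 ^ (L - 1) := hsum
    _ ≤ n := hLn

end CleanPair.Params

open CleanPair.Params in
/-- **Clean-pair atom §6 (scale parameters).**  For all `n ≥ 2^(2^22)` and every `Rc ≤ n^{3/4}`, the parameters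
`L := Nat.log 2 n + 1`, `a := 2^26 L²`, `r := 2(L/128+1)`, `q := 128 (a+1)² 2^(L/11+1)`, `s₀ := q²`,
`t₁ := Nat.log 2 (3 s₀)`, `D₀ := 2^(a-2L-2)`, `Φ₀ := (4(2a)²)^(Nat.log 2 (2a)+1) (Rc+1)` satisfy the sixteen
inequalities required by the clean-pair assembly (registered stub `stub_atomParams` of line `stub_poorRigidCore`). -/
theorem stub_atomParams : ∃ n₀ : ℕ, ∀ n ≥ n₀, ∀ Rc : ℕ, (Rc : ℝ) ≤ (n : ℝ) ^ ((3 : ℝ) / 4) → let L := Nat.log 2 n + 1; let a := 2 ^ 26 * L ^ 2; let r := 2 * (L / 128 + 1); let q := 128 * (a + 1) ^ 2 * 2 ^ (L / 11 + 1); let s₀ := q ^ 2; let t₁ := Nat.log 2 (3 * s₀); let D₀ := 2 ^ (a - 2 * L - 2); let Φ₀ := (4 * (2 * a) ^ 2) ^ (Nat.log 2 (2 * a) + 1) * (Rc + 1); 1 ≤ a ∧ 2 ≤ n ∧ r ≤ a ∧ 0 < s₀ ∧ ((2 * a : ℕ) : ℝ) ≤ (n : ℝ) ^ ((1 : ℝ)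 / 4) ∧ 2 * a ≤ ⌊(n : ℝ) ^ ((1 : ℝ) / 4)⌋₊ ∧ 288 * (a + 1) ^ 2 ≤ 2 ^ (r / 2) ∧ 3 * s₀ < 2 ^ (t₁ + 1) ∧ 64 * (a + 1) ^ 2 ≤ Nat.sqrt s₀ ∧ 3 * 2 ^ a < D₀ * 3 ^ (2 * L + 3 + 1) ∧ 3 * 2 ^ a * (64 * (a + 1) ^ 2) ^ (21 + 1) < D₀ * Nat.sqrt s₀ ^ (21 + 1) ∧ 2 ^ 21 * ((2 * L + 3) + (2 * L + 3) * t₁) ≤ a ∧ 2 ^ (a - (2 * L + 3) + 1) ≤ D₀ ∧ 2 * L + 3 ≤ a ∧ 4 * n ^ 2 * D₀ ≤ 3 * 2 ^ a ∧ 16 * (a + 1) * (Rc + 3 * 2 ^ (2 * r + 1) * Φ₀ + 6 * a * s₀ * Φ₀) + 16 * (a + 1) ^ 2 * (3 * 2 ^ (r + 1)) * (Φ₀ + 1) ≤ n := by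
  refine ⟨2 ^ 2 ^ 22, fun n hn Rc hRc => ?_⟩
  intro L a r q s₀ t₁ D₀ Φ₀
  obtain ⟨h2n, hLn, hnL, ℓ, w, hℓ, hwℓ, hEw, hwL⟩ := scale hn (rfl : L = Nat.log 2 n + 1)
  clear hn
  have hRc1 : Rc + 1 ≤ 2 ^ ((3 * L + 3) / 4) := rc_bound hRc hnL (by omega)
  obtain ⟨h1, h2, h3, h4⟩ := a_bounds (rfl : a = 2 ^ 26 * L ^ 2) hℓ
  obtain ⟨hs', ht'⟩ := q_bounds h2 (rfl : q = 128 * (a + 1) ^ 2 * 2 ^ (L / 11 + 1)) (rfl : s₀ = q ^ 2)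
    (rfl : t₁ = Nat.log 2 (3 * s₀))
  have hΦ' := phi_bound h3 h4 hRc1 (rfl : Φ₀ = (4 * (2 * a) ^ 2) ^ (Nat.log 2 (2 * a) + 1) * (Rc + 1))
  obtain ⟨c1, c3, c4, c8, c9, c10, c11, c13, c14, c15⟩ := part1 hnL (by omega) (rfl : a = 2 ^ 26 * L ^ 2)
    (rfl : r = 2 * (L / 128 + 1)) (rfl : q = 128 * (a + 1) ^ 2 * 2 ^ (L / 11 + 1)) (rfl : s₀ = q ^ 2)
    (rfl : t₁ = Nat.log 2 (3 * s₀)) (rfl : D₀ = 2 ^ (a - 2 * L - 2))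
  obtain ⟨c5, c7, c12⟩ := part2 hLn hwℓ hwL (rfl : a = 2 ^ 26 * L ^ 2) (rfl : r = 2 * (L / 128 + 1)) h1 h2 ht'
  have c16 := part3 hLn hwℓ hEw hwL (rfl : (3 * L + 3) / 4 = (3 * L + 3) / 4) hRc1
    (rfl : r = 2 * (L / 128 + 1)) h1 h2 hs' hΦ'
  exact ⟨c1, h2n, c3, c4, quarter_bound c5, Nat.le_floor (quarter_bound c5), c7, c8, c9, c10, c11, c12, c13,
    c14, c15, c16⟩

end Summit.MatrixMultiplication.MatrixMultiplication.Theorems.HyperoctahedralThreshold
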